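import Literature.NumberTheory.Automorphic.SupercuspidalPlaceNonvanishing
import Mathlib.MeasureTheory.Measure.Haar.Unique
import HarnessLib

/-!
# `GL_n(𝔸_K) = GL_n(K_v) × GL_n(𝔸_K)^{(v)}`: the splitting off of one finite place as a
# topological group and the factorisation of the Haar measure
(Bump, *Automorphic Forms and Representations* (1997), §3.3, p. 293 and Prop. 3.3.2:
`GL(n, 𝔸) = GL(n, F_v) × GL(n, 𝔸^v)` componentwise, Haar measure as a product; Gelbart,
*Automorphic forms on adele groups* (1975), §10, p. 153: `G_𝔸 = G_S × G^S`, `Φ = (∏_{v ∈ S} f_v) × f`)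

Topic `NumberTheory/Automorphic`; one definition with body (`GLn.placeSplitting`, a
`ContinuousMulEquiv`) and theorems; no named fact, no instance visible to importers.

The tree embeds `GL_n(K_v)` into `GL_n(𝔸_K)` (`GLn.toAdelic`, alias `GLn.ofLocal`), projects onto
the `v`-component (`GLn.toLocalAt`) and splits off the part away from `v`,
`s(g) = g ι_v(g_v)⁻¹` (`GLn.awayFrom`), with the algebra `g = ι_v(g_v) s(g)`,
`ι_v(a) h = h ι_v(a)` for `h` trivial at `v`, `s(g g') = s(g) s(g')`
(`GLnCuspidalSpectrumProofs`, `SupercuspidalPlaceNonvanishing`). Here this is packaged as the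
**internal direct product decomposition**

  `GLn.placeSplitting n K v : GL_n(K_v) × G^{(v)} ≃ₜ* GL_n(𝔸_K)`, `(a, h) ↦ ι_v(a) h`,

`G^{(v)} = ker (g ↦ g_v)` the closed subgroup of elements trivial at `v` (no restricted product
over the places is used), and the Haar measure is factorised accordingly:

* `GLn.placeSplitting_apply`, `…_symm_apply_fst/snd` — the formulas;
* `GLn.isClosed_ker_toLocalAt`, local compactness and second countability of `G^{(v)}`;
* `GLn.exists_map_placeSplitting_symm_eq_smul_prod` — **for Haar measures `ν` on `GL_n(𝔸_K)`,
  `μ_v` on `GL_n(K_v)` and `μ'` on `G^{(v)}` there is `κ > 0` with `(splitting⁻¹)_* ν = κ (μ_v ⊗ μ')`**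
  (uniqueness of Haar measure on `GL_n(K_v) × G^{(v)}`), hence
  `GLn.exists_lintegral_eq_mul_lintegral_lintegral`
  (`∫⁻ F dν = κ ∫⁻∫⁻ F(ι_v(a) h) dμ_v(a) dμ'(h)` for measurable `F ≥ 0`) and the Bochner form
  `GLn.exists_integral_eq_smul_integral_prod` (one `κ` for all integrands).

This is the measure-theoretic input for factorising convolutions and integrated operators of
product test functions `θ^{(v)} ⊗ ξ_v` (`localTestFunction`; `integratedOperator_prod_eq_comp` of
`IntegratedOperatorStar` on the product group), i.e. for building matched `*`-algebras of
factorizable test functions in the comparison of trace formulas.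

## References

* D. Bump, *Automorphic Forms and Representations* (1997), §3.3, Prop. 3.3.2 [Bump1997].
* S. Gelbart, *Automorphic forms on adele groups*, Ann. of Math. Studies 83 (1975), §10, p. 153
  [Gelbart1975].
-/

noncomputable section

open MeasureTheory Measure Set Filter Topology IsDedekindDomain NumberField
open scoped ENNReal NNReal

namespace Literature.NumberTheory.Automorphic

section Splitting

variable (n : ℕ) (K : Type) [Field K] [NumberField K] (v : HeightOneSpectrum (𝓞 K))

/-- An element trivial at `v` is its own part away from `v`: `s(h) = h` for `h_v = 1`. [folklore] -/
theorem GLn.awayFrom_eq_self_of_mem_ker {n : ℕ} {K : Type} [Field K] [NumberField K]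
    {v : HeightOneSpectrum (𝓞 K)} {h : (AdelicGroupData.gl n K).Adelic}
    (hh : h ∈ (GLn.toLocalAt n K v).ker) : GLn.awayFrom n K v h = h := by
  rw [MonoidHom.mem_ker] at hh
  unfold GLn.awayFrom
  rw [hh, map_one, inv_one, mul_one]

/-- The part of `g` away from `v` is trivial at `v`. [folklore] -/
theorem GLn.awayFrom_mem_ker {n : ℕ} {K : Type} [Field K] [NumberField K]
    {v : HeightOneSpectrum (𝓞 K)} (g : (AdelicGroupData.gl n K).Adelic) :
    GLn.awayFrom n K v g ∈ (GLn.toLocalAt n K v).ker := by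
  rw [MonoidHom.mem_ker, GLn.toLocal_awayFrom]

/-- **`GL_n(K_v) × G^{(v)} ≃ₜ* GL_n(𝔸_K)`, `(a, h) ↦ ι_v(a) h`** — the internal direct product
decomposition of `GL_n(𝔸_K)` into its `v`-component and the closed subgroup
`G^{(v)} = {h : h_v = 1}` of elements trivial at `v` (inverse `g ↦ (g_v, s(g))`,
`s(g) = g ι_v(g_v)⁻¹`; a homomorphism because `ι_v(a)` commutes with `G^{(v)}`). Bump (1997), §3.3:
`GL(n, 𝔸) = GL(n, F_v) × GL(n, 𝔸^v)`. [cite: Bump1997, §3.3 Prop. 3.3.2] -/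
def GLn.placeSplitting :
    GL (Fin n) (v.adicCompletion K) × (GLn.toLocalAt n K v).ker ≃ₜ* (AdelicGroupData.gl n K).Adelic where
  toFun p := GLn.toAdelic n K v p.1 * (p.2 : (AdelicGroupData.gl n K).Adelic)
  invFun g := (GLn.toLocalAt n K v g, ⟨GLn.awayFrom n K v g, GLn.awayFrom_mem_ker g⟩)
  left_inv p := by
    rcases p with ⟨a, h⟩
    have hh : GLn.toLocalAt n K v (h : (AdelicGroupData.gl n K).Adelic) = 1 := (MonoidHom.mem_ker).1 h.2
    ext
    · simp only [map_mul, GLn.toLocal_toAdelic, hh, mul_one]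
    · simp only [GLn.awayFrom_toAdelic_mul, GLn.awayFrom_eq_self_of_mem_ker h.2]
  right_inv g := by
    change GLn.toAdelic n K v (GLn.toLocalAt n K v g) * GLn.awayFrom n K v g = g
    rw [GLn.toAdelic_mul_awayFrom, GLn.awayFrom_mul_toAdelic]
  map_mul' p q := by
    rcases p with ⟨a, h⟩
    rcases q with ⟨a', h'⟩
    have hh : GLn.toLocalAt n K v (h : (AdelicGroupData.gl n K).Adelic) = 1 := (MonoidHom.mem_ker).1 h.2
    change GLn.toAdelic n K v (a * a') * ((h * h' : (GLn.toLocalAt n K v).ker) : (AdelicGroupData.gl n K).Adelic) =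
      GLn.toAdelic n K v a * (h : (AdelicGroupData.gl n K).Adelic) *
        (GLn.toAdelic n K v a' * (h' : (AdelicGroupData.gl n K).Adelic))
    rw [map_mul, Subgroup.coe_mul, mul_assoc, mul_assoc, ← mul_assoc (h : (AdelicGroupData.gl n K).Adelic),
      ← GLn.toAdelic_mul_eq_mul_toAdelic hh a', mul_assoc]
  continuous_toFun := ((GLn.continuous_toAdelic n K v).comp continuous_fst).mul
    (continuous_subtype_val.comp continuous_snd)
  continuous_invFun := (GLn.continuous_toLocalAt n K v).prodMk
    ((GLn.continuous_awayFrom n K v).subtype_mk _)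

variable {n K v}

/-- `placeSplitting (a, h) = ι_v(a) h` (definitional). [folklore] -/
@[simp]
theorem GLn.placeSplitting_apply (p : GL (Fin n) (v.adicCompletion K) × (GLn.toLocalAt n K v).ker) :
    GLn.placeSplitting n K v p = GLn.toAdelic n K v p.1 * (p.2 : (AdelicGroupData.gl n K).Adelic) := rfl

/-- The first component of the inverse is the `v`-component. [folklore] -/
@[simp]
theorem GLn.placeSplitting_symm_apply_fst (g : (AdelicGroupData.gl n K).Adelic) :
    ((GLn.placeSplitting n K v).symm g).1 = GLn.toLocalAt n K v g := rfl

/-- The second component of the inverse is the part away from `v`. [folklore] -/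
@[simp]
theorem GLn.placeSplitting_symm_apply_snd (g : (AdelicGroupData.gl n K).Adelic) :
    (((GLn.placeSplitting n K v).symm g).2 : (AdelicGroupData.gl n K).Adelic) = GLn.awayFrom n K v g := rfl

/-- `G^{(v)}` is closed (the kernel of the continuous projection onto the `v`-component).
[folklore] -/
theorem GLn.isClosed_ker_toLocalAt [T2Space (GL (Fin n) (v.adicCompletion K))] :
    IsClosed (((GLn.toLocalAt n K v).ker : Subgroup (AdelicGroupData.gl n K).Adelic) :
      Set (AdelicGroupData.gl n K).Adelic) := by
  have : (((GLn.toLocalAt n K v).ker : Subgroup (AdelicGroupData.gl n K).Adelic) :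
      Set (AdelicGroupData.gl n K).Adelic) = GLn.toLocalAt n K v ⁻¹' {1} := by
    ext g
    rw [SetLike.mem_coe, MonoidHom.mem_ker, Set.mem_preimage, Set.mem_singleton_iff]
  rw [this]
  exact isClosed_singleton.preimage (GLn.continuous_toLocalAt n K v)

end Splitting

/-! ### The Haar measure along the splitting -/

section Haar

variable {n : ℕ} {K : Type} [Field K] [NumberField K] {v : HeightOneSpectrum (𝓞 K)}

attribute [local instance] adelicBorel borelSpace_adelic locallyCompactSpace_adelic
  secondCountableTopology_gl_adelic

/-- **Factorisation of the Haar measure of `GL_n(𝔸_K)` along `GL_n(K_v) × G^{(v)}`, measure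
level** (Bump (1997), §3.3: "the Haar measure on `GL(n, 𝔸)` is the product of the local Haar
measures"). For a Haar measure `ν` on `GL_n(𝔸_K)` and Haar measures `μ_v` on `GL_n(K_v)`, `μ'` on
`G^{(v)}` there is `κ > 0` with `(splitting⁻¹)_* ν = κ · (μ_v ⊗ μ')`: the image of `ν` is a Haar
measure on the product (`ContinuousMulEquiv`), hence a positive multiple of the product Haar
measure (uniqueness, Mathlib `isMulLeftInvariant_eq_smul`). [cite: Bump1997, §3.3 Prop. 3.3.2] -/
theorem GLn.exists_map_placeSplitting_symm_eq_smul_prod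
    [MeasurableSpace (GL (Fin n) (v.adicCompletion K))] [BorelSpace (GL (Fin n) (v.adicCompletion K))]
    [SecondCountableTopology (GL (Fin n) (v.adicCompletion K))]
    [LocallyCompactSpace (GL (Fin n) (v.adicCompletion K))]
    (ν : Measure (AdelicGroupData.gl n K).Adelic) [ν.IsHaarMeasure]
    (μv : Measure (GL (Fin n) (v.adicCompletion K))) [μv.IsHaarMeasure]
    (μ' : Measure ((GLn.toLocalAt n K v).ker : Subgroup (AdelicGroupData.gl n K).Adelic)) [μ'.IsHaarMeasure] :
    ∃ κ : ℝ≥0, 0 < κ ∧ Measure.map (GLn.placeSplitting n K v).symm ν = κ • μv.prod μ' := by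
  haveI : T2Space (AdelicGroupData.gl n K).Adelic := t2Space_gl n K
  haveI : T2Space (GL (Fin n) (v.adicCompletion K)) :=
    T2Space.of_injective_continuous (f := GLn.toAdelic n K v) (GLn.toAdelic_injective)
      (GLn.continuous_toAdelic n K v)
  haveI : BorelSpace ((GLn.toLocalAt n K v).ker : Subgroup (AdelicGroupData.gl n K).Adelic) :=
    Subtype.borelSpace _
  haveI : SecondCountableTopology ((GLn.toLocalAt n K v).ker : Subgroup (AdelicGroupData.gl n K).Adelic) :=
    TopologicalSpace.Subtype.secondCountableTopology _
  haveI : BorelSpace (GL (Fin n) (v.adicCompletion K) ×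
      ((GLn.toLocalAt n K v).ker : Subgroup (AdelicGroupData.gl n K).Adelic)) := Prod.borelSpace
  haveI : LocallyCompactSpace ((GLn.toLocalAt n K v).ker : Subgroup (AdelicGroupData.gl n K).Adelic) :=
    (GLn.isClosed_ker_toLocalAt (n := n) (K := K) (v := v)).isClosedEmbedding_subtypeVal.locallyCompactSpace
  haveI : SigmaCompactSpace ((GLn.toLocalAt n K v).ker : Subgroup (AdelicGroupData.gl n K).Adelic) :=
    sigmaCompactSpace_of_locallyCompact_secondCountable
  haveI : SigmaCompactSpace (GL (Fin n) (v.adicCompletion K)) :=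
    sigmaCompactSpace_of_locallyCompact_secondCountable
  haveI : SFinite μ' := inferInstance
  haveI : SFinite μv := inferInstance
  set e := (GLn.placeSplitting n K v).symm with he
  haveI : (μv.prod μ').IsHaarMeasure := inferInstance
  haveI : (Measure.map e ν).IsHaarMeasure := e.toMulEquiv.isHaarMeasure_map ν e.continuous e.symm.continuous
  refine ⟨(Measure.map e ν).haarScalarFactor (μv.prod μ'),
    haarScalarFactor_pos_of_isHaarMeasure _ _, ?_⟩
  exact isMulLeftInvariant_eq_smul (Measure.map e ν) (μv.prod μ')

/-- **`∫⁻ F dν = κ ∫⁻ ∫⁻ F(ι_v(a) h) dμ_v(a) dμ'(h)`** for every measurable `F ≥ 0` (the measure-level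
factorisation `exists_map_placeSplitting_symm_eq_smul_prod`, transport along the splitting and
Tonelli). [cite: Bump1997, §3.3 Prop. 3.3.2] -/
theorem GLn.exists_lintegral_eq_mul_lintegral_lintegral
    [MeasurableSpace (GL (Fin n) (v.adicCompletion K))] [BorelSpace (GL (Fin n) (v.adicCompletion K))]
    [SecondCountableTopology (GL (Fin n) (v.adicCompletion K))]
    [LocallyCompactSpace (GL (Fin n) (v.adicCompletion K))]
    (ν : Measure (AdelicGroupData.gl n K).Adelic) [ν.IsHaarMeasure]
    (μv : Measure (GL (Fin n) (v.adicCompletion K))) [μv.IsHaarMeasure]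
    (μ' : Measure ((GLn.toLocalAt n K v).ker : Subgroup (AdelicGroupData.gl n K).Adelic)) [μ'.IsHaarMeasure] :
    ∃ κ : ℝ≥0, 0 < κ ∧ ∀ F : (AdelicGroupData.gl n K).Adelic → ℝ≥0∞, Measurable F →
      ∫⁻ g, F g ∂ν = κ * ∫⁻ h, ∫⁻ a, F (GLn.toAdelic n K v a * (h : (AdelicGroupData.gl n K).Adelic)) ∂μv ∂μ' := by
  haveI : T2Space (AdelicGroupData.gl n K).Adelic := t2Space_gl n K
  haveI : BorelSpace ((GLn.toLocalAt n K v).ker : Subgroup (AdelicGroupData.gl n K).Adelic) :=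
    Subtype.borelSpace _
  haveI : SecondCountableTopology ((GLn.toLocalAt n K v).ker : Subgroup (AdelicGroupData.gl n K).Adelic) :=
    TopologicalSpace.Subtype.secondCountableTopology _
  haveI : BorelSpace (GL (Fin n) (v.adicCompletion K) ×
      ((GLn.toLocalAt n K v).ker : Subgroup (AdelicGroupData.gl n K).Adelic)) := Prod.borelSpace
  haveI : LocallyCompactSpace ((GLn.toLocalAt n K v).ker : Subgroup (AdelicGroupData.gl n K).Adelic) :=
    (GLn.isClosed_ker_toLocalAt (n := n) (K := K) (v := v)).isClosedEmbedding_subtypeVal.locallyCompactSpace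
  haveI : SigmaCompactSpace ((GLn.toLocalAt n K v).ker : Subgroup (AdelicGroupData.gl n K).Adelic) :=
    sigmaCompactSpace_of_locallyCompact_secondCountable
  haveI : SFinite μ' := inferInstance
  obtain ⟨κ, hκ, hmap⟩ := GLn.exists_map_placeSplitting_symm_eq_smul_prod (n := n) (K := K) (v := v) ν μv μ'
  refine ⟨κ, hκ, fun F hF => ?_⟩
  set e := (GLn.placeSplitting n K v).symm with he
  set em : (AdelicGroupData.gl n K).Adelic ≃ᵐ GL (Fin n) (v.adicCompletion K) ×
      ((GLn.toLocalAt n K v).ker : Subgroup (AdelicGroupData.gl n K).Adelic) :=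
    e.toHomeomorph.toMeasurableEquiv with hem
  have hem' : (em : _ → _) = e := rfl
  have hG : Measurable fun p : GL (Fin n) (v.adicCompletion K) ×
      ((GLn.toLocalAt n K v).ker : Subgroup (AdelicGroupData.gl n K).Adelic) => F (e.symm p) :=
    hF.comp e.symm.continuous.measurable
  have h1 : ∫⁻ g, F g ∂ν = ∫⁻ p, F (e.symm p) ∂(Measure.map e ν) := by
    rw [← hem', lintegral_map_equiv]
    simp only [hem', ContinuousMulEquiv.symm_apply_apply]
  rw [h1, hmap, lintegral_smul_measure, lintegral_prod_symm _ hG.aemeasurable]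
  congr 1

/-- **Bochner form: `∫ F dν = κ • ∫ F(ι_v(a) h) d(μ_v ⊗ μ')(a, h)`** for every `F` (no integrability
needed: both sides vanish together), with the same `κ` for all integrands; combine with Fubini
(`MeasureTheory.integral_prod`) for integrable `F`. [cite: Bump1997, §3.3 Prop. 3.3.2] -/
theorem GLn.exists_integral_eq_smul_integral_prod
    [MeasurableSpace (GL (Fin n) (v.adicCompletion K))] [BorelSpace (GL (Fin n) (v.adicCompletion K))]
    [SecondCountableTopology (GL (Fin n) (v.adicCompletion K))]
    [LocallyCompactSpace (GL (Fin n) (v.adicCompletion K))]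
    (ν : Measure (AdelicGroupData.gl n K).Adelic) [ν.IsHaarMeasure]
    (μv : Measure (GL (Fin n) (v.adicCompletion K))) [μv.IsHaarMeasure]
    (μ' : Measure ((GLn.toLocalAt n K v).ker : Subgroup (AdelicGroupData.gl n K).Adelic)) [μ'.IsHaarMeasure]
    {E : Type*} [NormedAddCommGroup E] [NormedSpace ℝ E] :
    ∃ κ : ℝ≥0, 0 < κ ∧ ∀ F : (AdelicGroupData.gl n K).Adelic → E,
      ∫ g, F g ∂ν = (κ : ℝ) • ∫ p : GL (Fin n) (v.adicCompletion K) ×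
          ((GLn.toLocalAt n K v).ker : Subgroup (AdelicGroupData.gl n K).Adelic),
        F (GLn.toAdelic n K v p.1 * (p.2 : (AdelicGroupData.gl n K).Adelic)) ∂(μv.prod μ') := by
  haveI : T2Space (AdelicGroupData.gl n K).Adelic := t2Space_gl n K
  haveI : BorelSpace ((GLn.toLocalAt n K v).ker : Subgroup (AdelicGroupData.gl n K).Adelic) :=
    Subtype.borelSpace _
  haveI : SecondCountableTopology ((GLn.toLocalAt n K v).ker : Subgroup (AdelicGroupData.gl n K).Adelic) :=
    TopologicalSpace.Subtype.secondCountableTopology _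
  haveI : BorelSpace (GL (Fin n) (v.adicCompletion K) ×
      ((GLn.toLocalAt n K v).ker : Subgroup (AdelicGroupData.gl n K).Adelic)) := Prod.borelSpace
  obtain ⟨κ, hκ, hmap⟩ := GLn.exists_map_placeSplitting_symm_eq_smul_prod (n := n) (K := K) (v := v) ν μv μ'
  refine ⟨κ, hκ, fun F => ?_⟩
  set e := (GLn.placeSplitting n K v).symm with he
  set em : (AdelicGroupData.gl n K).Adelic ≃ᵐ GL (Fin n) (v.adicCompletion K) ×
      ((GLn.toLocalAt n K v).ker : Subgroup (AdelicGroupData.gl n K).Adelic) :=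
    e.toHomeomorph.toMeasurableEquiv with hem
  have hem' : (em : _ → _) = e := rfl
  have h1 : ∫ g, F g ∂ν = ∫ p, F (e.symm p) ∂(Measure.map e ν) := by
    rw [← hem', integral_map_equiv]
    simp only [hem', ContinuousMulEquiv.symm_apply_apply]
  rw [h1, hmap, integral_smul_nnreal_measure]
  rfl

end Haar

end Literature.NumberTheory.Automorphic
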